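import Summits.BirchSwinnertonDyer.BirchSwinnertonDyer.Theorems.GenusKolyvaginAtTwoPowDvdShaCardAtTwoRTLocalKernelOneBitLocal
import Summits.BirchSwinnertonDyer.BirchSwinnertonDyer.Theorems.GenusKolyvaginAtTwoPowDvdShaCardAtTwoRTTwoTorsionQuadratic
import Summits.BirchSwinnertonDyer.BirchSwinnertonDyer.Theorems.GenusKolyvaginAtTwoGenusPrimitiveSupplyAtTwoLocalTwoTorsion
import Summits.BirchSwinnertonDyer.BirchSwinnertonDyer.Theorems.GenusKolyvaginAtTwoGenusPrimitiveSupplyAtTwoPrimeHeegnerTwinPosDisc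
import Literature.NumberTheory.EllipticCurves.LocalPointsPlaceTransportProofs
import HarnessLib

/-!
# Route `GenusKolyvaginAtTwo`, LINE 18 / LINE 19 (L_T stmt-BirchSwinnertonDyer-23242, L⁺_T stmt-23379), critic #179
# price (1): THE ONE-BIT BOUND IN THE CELL'S CURRENCIES — `#W_{v,K} ≤ #E(ℚ_q)[2] = 1 + #{roots of ψ mod q} = #Ẽ(𝔽_q)[2]`
# at a ramified odd good prime; `W = 0` at a silent prime (`a_q` odd), `#W ≤ 2` at a transposition prime

Seat `bsd-line-gk2-p3` g17 (cell `bsd-f1-sign2`), `--supports stmt-BirchSwinnertonDyer-23242` (helper; closes nothing).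
THEOREMS ONLY (no definition, no named fact, no `sorry`); BSD is not proved by any of this.

The sibling file `…RTLocalKernelOneBitLocal` proves `#W_{v,K} ≤ #E(ℚ_v)[2]` for Matsuno's local kernel
`W_{v,K} = ker(H¹(ℚ_v, E) → H¹(K_w, E))` at a quadratic place `w ∣ v ∤ 2`, with `E(ℚ_v)` the points over the tree's
completion `v.adicCompletion ℚ`.  The cell's local `2`-torsion currency is Mathlib's `ℚ_[q]` (Mazur–Rubin named facts,
seat gk2-p5's Hensel bridge `GenusKolyTwin.natCard_twoTorsion_padic_eq`: `#E(ℚ_q)[2] = #{x̄ ∈ 𝔽_q : ψ(x̄) = 0} + 1` for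
the `2`-division cubic `ψ` of the minimal model at an odd `q ∤ Δ_min`).  This file moves the bound across
`Rat.HeightOneSpectrum.padicEquiv` (tree `WeierstrassCurve.natCard_ker_nsmul_adicCompletion_eq_padic`,
file `LocalPointsPlaceTransportProofs`) and reads it in the DEF / transposition /
silent dictionary of crux 22136 and in the `a_q`-parity dictionary of LINE 18/19 (`i_q = dim Ẽ(𝔽_q)[2]`):

* §1 `natCard_twoTorsion_adicCompletion_eq_padic`, `forall_two_smul_eq_zero_adicCompletion_iff_padic` — `E(ℚ_v)[2]`
  versus `E(ℚ_[p])[2]` for the place `v ∋ p` (subtype currency of the tree's kernel-currency transport).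
* §2 `natCard_localKernel_le_natCard_twoTorsion_padic` — `#W_{v,K} ≤ #E(ℚ_[p])[2]` (`[K_w : ℚ_v] = 2`, `w ∤ 2`);
  `two_not_mem_of_liesOver` — `w ∤ 2` from `v ∤ 2`.
* §3 at `v = Matsuno2009.primePlace q`, `q` an odd prime with `q ∤ Δ_min(W)` (`W` globally minimal):
  `natCard_localKernel_le_ncard_roots_add_one` — **`#W_{q,K} ≤ #{x̄ ∈ 𝔽_q : ψ(x̄) = 0} + 1 = #Ẽ(𝔽_q)[2]`**;
  `localKernel_primePlace_eq_bot_of_forall_ne` / `…_of_odd_frobeniusTrace` — **silent prime (`a_q` odd) ⟹ `W_{q,K} = 0`**;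
  `natCard_localKernel_le_two_of_existsUnique` / `…_of_jacobiSym_eq_neg_one` — **transposition prime ⟹ `#W_{q,K} ≤ 2`**
  (exactly the ONE relaxed bit per transposition prime of `d_K` budgeted by the instrument law
  `e_an = Σ_{v ∣ d_K∞} i_v − 1` of the pen's kit j318164 / j318378).

References: [Kramer1981] §2 Prop. 3; [Matsuno2009] §3, Lemma 4.2; [MazurRubin2010] Lemma 2.2 (i); [SilvermanAEC2009]
VII.3.1(b), VII.6.3.
-/

set_option autoImplicit false
-- the Theorems namespace of this sub repeats the summit name by design (D-0017 nested layout)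
set_option linter.dupNamespace false

noncomputable section

open scoped Classical

namespace Summit.BirchSwinnertonDyer.BirchSwinnertonDyer.Theorems.GenusExact.PlusDescent

open WeierstrassCurve NumberField IsDedekindDomain Rat.HeightOneSpectrum Literature.NumberTheory.EllipticCurves
  Literature.Barriers.BirchSwinnertonDyer

/-! ## §1 `E(ℚ_v)[2]` versus `E(ℚ_[p])[2]` -/

section Padic

variable (E : WeierstrassCurve ℚ) (v : HeightOneSpectrum (𝓞 ℚ)) {p : ℕ} [Fact p.Prime]

/-- **`#E(ℚ_v)[2] = #E(ℚ_[p])[2]`** for the finite place `v ∋ p` of `ℚ`, in the subtype currency `{P // 2 • P = 0}` of the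
cell's Mazur–Rubin facts: the points of `E` over the tree's completion `ℚ_v = v.adicCompletion ℚ` and over Mathlib's
`ℚ_[p]` are isomorphic along `Rat.HeightOneSpectrum.padicEquiv` (tree
`WeierstrassCurve.natCard_ker_nsmul_adicCompletion_eq_padic`, stated on the kernels of multiplication by `2`). [folklore] -/
theorem natCard_twoTorsion_adicCompletion_eq_padic (hpv : (p : 𝓞 ℚ) ∈ v.asIdeal) :
    Nat.card {P : (E.baseChange (v.adicCompletion ℚ)).toAffine.Point // 2 • P = 0} =
      Nat.card {Q : (E.baseChange ℚ_[p]).toAffine.Point // 2 • Q = 0} := by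
  have h := E.natCard_ker_nsmul_adicCompletion_eq_padic hpv 2
  rw [Nat.card_congr (Equiv.subtypeEquivRight (p := fun P ↦
      P ∈ (nsmulAddMonoidHom 2 : (E.baseChange (v.adicCompletion ℚ)).toAffine.Point →+ _).ker)
      fun P ↦ by rw [AddMonoidHom.mem_ker, nsmulAddMonoidHom_apply]),
    Nat.card_congr (Equiv.subtypeEquivRight (p := fun Q ↦
      Q ∈ (nsmulAddMonoidHom 2 : (E.baseChange ℚ_[p]).toAffine.Point →+ _).ker)
      fun Q ↦ by rw [AddMonoidHom.mem_ker, nsmulAddMonoidHom_apply])] at h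
  exact h

/-- **`E(ℚ_v)[2] = 0 ↔ E(ℚ_[p])[2] = 0`** for the place `v ∋ p` (tree
`WeierstrassCurve.forall_nsmul_eq_zero_adicCompletion_iff_padic` at `n = 2`). [folklore] -/
theorem forall_two_smul_eq_zero_adicCompletion_iff_padic (hpv : (p : 𝓞 ℚ) ∈ v.asIdeal) :
    (∀ P : (E.baseChange (v.adicCompletion ℚ)).toAffine.Point, 2 • P = 0 → P = 0) ↔
      ∀ Q : (E.baseChange ℚ_[p]).toAffine.Point, 2 • Q = 0 → Q = 0 :=
  E.forall_nsmul_eq_zero_adicCompletion_iff_padic hpv 2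

end Padic

/-! ## §2 `#W_{v,K} ≤ #E(ℚ_[p])[2]` -/

section Local

variable (E : WeierstrassCurve ℚ) [E.IsElliptic] (K : Type) [Field K] [NumberField K]
  (v : HeightOneSpectrum (𝓞 ℚ)) (w : HeightOneSpectrum (𝓞 K)) [w.asIdeal.LiesOver v.asIdeal]

omit [E.IsElliptic] in
/-- `w ∤ 2` for a place `w` of `K` above a place `v ∤ 2` of `ℚ` (`w ∩ 𝓞_ℚ = v`). [folklore] -/
theorem two_not_mem_of_liesOver (hv2 : ((2 : ℕ) : 𝓞 ℚ) ∉ v.asIdeal) : ((2 : ℕ) : 𝓞 K) ∉ w.asIdeal := by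
  intro h
  apply hv2
  rw [(inferInstance : w.asIdeal.LiesOver v.asIdeal).over, Ideal.under_def, Ideal.mem_comap, map_natCast]
  exact h

/-- **`#W_{v,K} ≤ #E(ℚ_[p])[2]`** at a quadratic place `w ∣ v ∤ 2` (`p` the prime under `v`): the one-bit bound
`natCard_localKernel_le_natCard_twoTorsion` read in Mathlib's `ℚ_[p]` (`natCard_twoTorsion_adicCompletion_eq_padic`), `v ∋ p`.
Kramer 1981 Prop. 3 (upper half). [cite: Kramer1981, §2 Prop. 3] [cite: Matsuno2009, §3 (p. 451, W_{v,K})] -/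
theorem natCard_localKernel_le_natCard_twoTorsion_padic {p : ℕ} [Fact p.Prime] (hpv : (p : 𝓞 ℚ) ∈ v.asIdeal)
    (h2 : letI : Algebra (v.adicCompletion ℚ) (w.adicCompletion K) :=
        (Literature.NumberTheory.EllipticCurves.adicCompletionMap (K := ℚ) K v w).toAlgebra
      Module.finrank (v.adicCompletion ℚ) (w.adicCompletion K) = 2)
    (hw : ((2 : ℕ) : 𝓞 K) ∉ w.asIdeal) :
    Finite (Matsuno2009.localKernel E K v w) ∧
      Nat.card (Matsuno2009.localKernel E K v w) ≤ Nat.card {Q : (E.baseChange ℚ_[p]).toAffine.Point // 2 • Q = 0} := by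
  rw [← natCard_twoTorsion_adicCompletion_eq_padic E v hpv]
  exact natCard_localKernel_le_natCard_twoTorsion E K v w h2 hw

end Local

/-! ## §3 At an odd good prime `q`: the DEF / transposition / silent dictionary -/

section PrimePlace

variable (W : WeierstrassCurve ℚ) [W.IsElliptic] [W.IsGloballyMinimal] {q : ℕ} [Fact q.Prime]
  (K : Type) [Field K] [NumberField K] (w : HeightOneSpectrum (𝓞 K))
  [w.asIdeal.LiesOver (Matsuno2009.primePlace q).asIdeal]

omit [W.IsElliptic] [W.IsGloballyMinimal] in
/-- `2 ∉ v` at `v = Matsuno2009.primePlace q`, `q` an odd prime (Bézout: `q` and `2` both in `v` would put `1` in `v`;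
the case `n = 2` of the tree's `Matsuno2009.natCast_not_mem_primePlace`, file `…MatsunoLemma42Proofs`). [folklore] -/
theorem two_not_mem_primePlace (hq2 : q ≠ 2) : ((2 : ℕ) : 𝓞 ℚ) ∉ (Matsuno2009.primePlace q).asIdeal := by
  have hq : q.Prime := Fact.out
  intro h2
  have hcop : IsCoprime (q : ℤ) ((2 : ℕ) : ℤ) :=
    Nat.isCoprime_iff_coprime.mpr (hq.coprime_iff_not_dvd.mpr fun h ↦
      hq2 ((Nat.prime_dvd_prime_iff_eq hq Nat.prime_two).mp h))
  obtain ⟨a, b, hab⟩ := hcop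
  have h1 : (1 : 𝓞 ℚ) ∈ (Matsuno2009.primePlace q).asIdeal := by
    have hcast := congrArg (Int.cast : ℤ → 𝓞 ℚ) hab
    push_cast at hcast
    rw [← hcast]
    exact Ideal.add_mem _ (Ideal.mul_mem_left _ _ (Matsuno2009.natCast_mem_primePlace hq))
      (Ideal.mul_mem_left _ _ (by exact_mod_cast h2))
  exact (Matsuno2009.primePlace q).isPrime.ne_top ((Ideal.eq_top_iff_one _).mpr h1)

omit [W.IsElliptic] [W.IsGloballyMinimal] in
/-- `w ∤ 2` for `w` above `Matsuno2009.primePlace q`, `q` an odd prime. [folklore] -/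
theorem two_not_mem_of_liesOver_primePlace (hq2 : q ≠ 2) : ((2 : ℕ) : 𝓞 K) ∉ w.asIdeal :=
  two_not_mem_of_liesOver K (Matsuno2009.primePlace q) w (two_not_mem_primePlace hq2)

/-- **`#W_{q,K} ≤ #{x̄ ∈ 𝔽_q : ψ(x̄) = 0} + 1` (`= #Ẽ(𝔽_q)[2] = 2^{i_q}`)** for `W/ℚ` globally minimal elliptic, `q` an odd
prime with `q ∤ Δ_min(W)` (good reduction), `K` a number field and `w ∣ q` with `[K_w : ℚ_q] = 2` (e.g. `q ∣ d_K` ramified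
in a quadratic `K`): Matsuno's `W_{q,K}` is finite of order at most one more than the number of roots mod `q` of the
`2`-division cubic `ψ = 4x³ + b₂x² + 2b₄x + b₆` of the minimal model — Kramer's `2^{i_q}`, `i_q = dim Ẽ(𝔽_q)[2]`.  One-bit
bound `natCard_localKernel_le_natCard_twoTorsion_padic` + gk2-p5's Hensel count `GenusKolyTwin.natCard_twoTorsion_padic_eq`.
[cite: Kramer1981, §2 Prop. 3] [cite: SilvermanAEC2009, VII.3 Prop. 3.1(b)] [cite: MazurRubin2010, Lemma 2.2 (i)] -/
theorem natCard_localKernel_le_ncard_roots_add_one (hq2 : q ≠ 2) (hqΔ : ¬ (q : ℤ) ∣ minimalDiscriminantInt W)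
    (h2 : letI : Algebra ((Matsuno2009.primePlace q).adicCompletion ℚ) (w.adicCompletion K) :=
        (Literature.NumberTheory.EllipticCurves.adicCompletionMap (K := ℚ) K (Matsuno2009.primePlace q) w).toAlgebra
      Module.finrank ((Matsuno2009.primePlace q).adicCompletion ℚ) (w.adicCompletion K) = 2) :
    Finite (Matsuno2009.localKernel W K (Matsuno2009.primePlace q) w) ∧
      Nat.card (Matsuno2009.localKernel W K (Matsuno2009.primePlace q) w) ≤
        {x : ZMod q | 4 * x ^ 3 + ((integralModelInt W).b₂ : ZMod q) * x ^ 2 +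
          2 * ((integralModelInt W).b₄ : ZMod q) * x + ((integralModelInt W).b₆ : ZMod q) = 0}.ncard + 1 := by
  obtain ⟨hfin, hle⟩ := natCard_localKernel_le_natCard_twoTorsion_padic W K (Matsuno2009.primePlace q) w
    (Matsuno2009.natCast_mem_primePlace Fact.out) h2 (two_not_mem_of_liesOver_primePlace K w hq2)
  exact ⟨hfin, hle.trans_eq (GenusKolyTwin.natCard_twoTorsion_padic_eq W hq2 hqΔ)⟩

/-- **Silent prime ⟹ `W_{q,K} = 0`.** If the `2`-division cubic of the minimal model has NO root mod the odd good prime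
`q` (`Ẽ(𝔽_q)[2] = 0`, `i_q = 0`), then `W_{q,K} = 0` at every `w ∣ q` with `[K_w : ℚ_q] = 2`: the `d_K`-relaxed local
condition of the (+)-descent coincides with the Selmer condition at `q` (`GenusKolyTwin.twoTorsion_padic_eq_zero_of_forall_ne`
+ `localKernel_eq_bot_of_finrank_eq_two_of_forall_two_smul_rat`). [cite: Kramer1981, §2 Prop. 3]
[cite: MazurRubin2010, Lemma 2.2 (i) and Cor. 3.4 (ii)] -/
theorem localKernel_primePlace_eq_bot_of_forall_ne (hq2 : q ≠ 2) (hqΔ : ¬ (q : ℤ) ∣ minimalDiscriminantInt W)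
    (h2 : letI : Algebra ((Matsuno2009.primePlace q).adicCompletion ℚ) (w.adicCompletion K) :=
        (Literature.NumberTheory.EllipticCurves.adicCompletionMap (K := ℚ) K (Matsuno2009.primePlace q) w).toAlgebra
      Module.finrank ((Matsuno2009.primePlace q).adicCompletion ℚ) (w.adicCompletion K) = 2)
    (hsil : ∀ x : ZMod q, 4 * x ^ 3 + ((integralModelInt W).b₂ : ZMod q) * x ^ 2 +
      2 * ((integralModelInt W).b₄ : ZMod q) * x + ((integralModelInt W).b₆ : ZMod q) ≠ 0) :
    Matsuno2009.localKernel W K (Matsuno2009.primePlace q) w = ⊥ :=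
  localKernel_eq_bot_of_finrank_eq_two_of_forall_two_smul_rat W K (Matsuno2009.primePlace q) w h2
    (two_not_mem_of_liesOver_primePlace K w hq2)
    ((forall_two_smul_eq_zero_adicCompletion_iff_padic W (Matsuno2009.primePlace q)
      (Matsuno2009.natCast_mem_primePlace (Fact.out : q.Prime))).mpr
      (GenusKolyTwin.twoTorsion_padic_eq_zero_of_forall_ne W hq2 hqΔ hsil))

/-- **`a_q` odd ⟹ `W_{q,K} = 0`**: the same in the `a_q`-parity currency of LINE 18/19 (`GenusKolyTwin.silent_iff_odd_frobeniusTrace`: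
no root of `ψ` mod `q` iff `#Ẽ(𝔽_q) = q + 1 − a_q` is odd). [cite: Kramer1981, §2 Prop. 3] [cite: SilvermanAEC2009, Ex. III.3.7 (d)] -/
theorem localKernel_primePlace_eq_bot_of_odd_frobeniusTrace (hq2 : q ≠ 2) (hqΔ : ¬ (q : ℤ) ∣ minimalDiscriminantInt W)
    (h2 : letI : Algebra ((Matsuno2009.primePlace q).adicCompletion ℚ) (w.adicCompletion K) :=
        (Literature.NumberTheory.EllipticCurves.adicCompletionMap (K := ℚ) K (Matsuno2009.primePlace q) w).toAlgebra
      Module.finrank ((Matsuno2009.primePlace q).adicCompletion ℚ) (w.adicCompletion K) = 2)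
    (hodd : Odd (W.frobeniusTrace q)) :
    Matsuno2009.localKernel W K (Matsuno2009.primePlace q) w = ⊥ :=
  localKernel_primePlace_eq_bot_of_forall_ne W K w hq2 hqΔ h2
    ((GenusKolyTwin.silent_iff_odd_frobeniusTrace W hq2 hqΔ).mpr hodd)

/-- **Transposition prime ⟹ `#W_{q,K} ≤ 2`.** If `ψ` has EXACTLY ONE root mod the odd good prime `q` (`#E(ℚ_q)[2] = 2`,
`i_q = 1` — a T-prime of `MazurRubin2010.prop33_rat`, a DEF prime of the cell), then `#W_{q,K} ≤ 2` at every quadratic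
`w ∣ q`: the `d_K`-relaxation of the (+)-descent costs AT MOST ONE BIT there.
[cite: Kramer1981, §2 Prop. 3] [cite: MazurRubin2010, Lemma 2.2 (i) and Prop. 3.3] -/
theorem natCard_localKernel_le_two_of_existsUnique (hq2 : q ≠ 2) (hqΔ : ¬ (q : ℤ) ∣ minimalDiscriminantInt W)
    (h2 : letI : Algebra ((Matsuno2009.primePlace q).adicCompletion ℚ) (w.adicCompletion K) :=
        (Literature.NumberTheory.EllipticCurves.adicCompletionMap (K := ℚ) K (Matsuno2009.primePlace q) w).toAlgebra
      Module.finrank ((Matsuno2009.primePlace q).adicCompletion ℚ) (w.adicCompletion K) = 2)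
    (h : ∃! x : ZMod q, 4 * x ^ 3 + ((integralModelInt W).b₂ : ZMod q) * x ^ 2 +
      2 * ((integralModelInt W).b₄ : ZMod q) * x + ((integralModelInt W).b₆ : ZMod q) = 0) :
    Finite (Matsuno2009.localKernel W K (Matsuno2009.primePlace q) w) ∧
      Nat.card (Matsuno2009.localKernel W K (Matsuno2009.primePlace q) w) ≤ 2 := by
  obtain ⟨hfin, hle⟩ := natCard_localKernel_le_natCard_twoTorsion_padic W K (Matsuno2009.primePlace q) w
    (Matsuno2009.natCast_mem_primePlace Fact.out) h2 (two_not_mem_of_liesOver_primePlace K w hq2)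
  exact ⟨hfin, hle.trans_eq (GenusKolyTwin.natCard_twoTorsion_padic_eq_two_of_existsUnique W hq2 hqΔ h)⟩

/-- **`(Δ_min / q) = −1` ⟹ `#W_{q,K} ≤ 2`**: at an odd prime `q ∤ Δ_min(W)` where the minimal discriminant is a quadratic
non-residue the Frobenius is a transposition on `E[2]` (Stickelberger; `GenusKolyTwin.natCard_twoTorsion_padic_eq_two_of_jacobiSym_eq_neg_one`),
so `#E(ℚ_q)[2] = 2` and `#W_{q,K} ≤ 2`. [cite: Kramer1981, §2 Prop. 3] [cite: MazurRubin2010, Lemma 2.2 (i)] -/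
theorem natCard_localKernel_le_two_of_jacobiSym_eq_neg_one (hq2 : q ≠ 2) (hqΔ : ¬ (q : ℤ) ∣ minimalDiscriminantInt W)
    (h2 : letI : Algebra ((Matsuno2009.primePlace q).adicCompletion ℚ) (w.adicCompletion K) :=
        (Literature.NumberTheory.EllipticCurves.adicCompletionMap (K := ℚ) K (Matsuno2009.primePlace q) w).toAlgebra
      Module.finrank ((Matsuno2009.primePlace q).adicCompletion ℚ) (w.adicCompletion K) = 2)
    (hJ : jacobiSym (minimalDiscriminantInt W) q = -1) :
    Finite (Matsuno2009.localKernel W K (Matsuno2009.primePlace q) w) ∧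
      Nat.card (Matsuno2009.localKernel W K (Matsuno2009.primePlace q) w) ≤ 2 := by
  obtain ⟨hfin, hle⟩ := natCard_localKernel_le_natCard_twoTorsion_padic W K (Matsuno2009.primePlace q) w
    (Matsuno2009.natCast_mem_primePlace Fact.out) h2 (two_not_mem_of_liesOver_primePlace K w hq2)
  exact ⟨hfin, hle.trans_eq (GenusKolyTwin.natCard_twoTorsion_padic_eq_two_of_jacobiSym_eq_neg_one W hq2 hqΔ hJ)⟩

end PrimePlace

end Summit.BirchSwinnertonDyer.BirchSwinnertonDyer.Theorems.GenusExact.PlusDescent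

end
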